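import Summits.QuantumFields.YangMills.Theorems.ConvexGribovBodyNonSimplyConnectedLatticeGapWeakMixingFunnel
import HarnessLib

/-!
# Gauge-invariant DLR states agreeing on gauge-invariant local observables are equal
# (stub `stub_dlr_eq_of_gaugeInvariantAgreement` (EZ2, gauge averaging) of crux stmt-QuantumFields-16405
# `NonSimplyConnectedLatticeGap`, route `ConvexGribovBody`, line `Sketch` v7)

For lattice `G`-gauge theory on `ℤ⁴` (compact metrisable `G`): two probability measures `μ, ν` on
`LGConfig 4 G = (ZdEdge 4 → G)` which are both invariant under every lattice gauge transformation
`gaugeTransformZd g` and have the same expectation of every gauge-invariant local observable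
`A : LocalGaugeObservable 4 G` are equal. (The DLR hypotheses `μ, ν ∈ ymGibbsMeasures ρ β` of the registered
signature are only used to know that `μ` and `ν` are probability measures.)

Proof (gauge averaging). Fix a bounded measurable cylinder function `f` with `DependsOn f ↑S`, let `V` be a
finite set of sites containing both endpoints of every edge of `S`, and average `f` over the gauge group at
the sites of `V` with the product Haar probability measure `Measure.pi fun _ : V => haarProbability G`:
`f̄ U = ∫ f (gaugeTransformZd (ext k) U) dk`, where `ext k = Function.extend Subtype.val k 1` is `k : V → G`
extended by `1` off `V`.
* `f̄` is again a bounded measurable `S`-cylinder function, and it is gauge INVARIANT: `gaugeTransformZd` is an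
  action, `f ∘ gaugeTransformZd (ext k · h)` only sees `h` at the sites of `V` (so equals
  `f ∘ gaugeTransformZd (ext (k · h|_V))`), and the finite product of Haar probability measures is right
  invariant (compact groups are unimodular). Hence `⟨f̄, S, …⟩ : LocalGaugeObservable 4 G`.
* `∫ f̄ dμ = ∫ f dμ` for a gauge-invariant `μ` (Fubini and `μ.map (gaugeTransformZd g) = μ`); same for `ν`.
So `μ` and `ν` integrate every bounded measurable cylinder function identically, in particular the indicators
of the measurable cylinder sets, a π-system generating the product σ-algebra
(`MeasureTheory.generateFrom_measurableCylinders`); `MeasureTheory.ext_of_generate_finite` concludes.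

References: E. Seiler, LNP 159 (1982), Ch. 2 (gauge invariance of DLR states); H.-O. Georgii, *Gibbs Measures
and Phase Transitions* (2011), §1.3 (measures determined on cylinder events). The file declares no definition:
the gauge average is written out as an integral in every statement, and all helpers are `private` theorems
(generic names, to avoid clashes with the sibling stub files of the line).
-/

set_option autoImplicit false

noncomputable section

open MeasureTheory Filter Topology
open Literature.Probability.LatticeModels
open Literature.MathematicalPhysics.QuantumLattice
open Literature.MathematicalPhysics.QuantumFieldTheory (haarProbability)

namespace Summit.QuantumFields.YangMills.Theorems.NonSimplyConnectedLatticeGap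

section GaugeAveraging

variable {G : Type} [Group G]

/-- Gauge transformations compose: `T_g (T_h U) = T_{g h}` (pointwise product of gauge functions). -/
private theorem gaugeTransformZd_gaugeTransformZd (g h : Site 4 → G) (U : LGConfig 4 G) :
    gaugeTransformZd g (gaugeTransformZd h U) = gaugeTransformZd (g * h) U := by
  funext e
  simp only [gaugeTransformZd, Pi.mul_apply, mul_inv_rev, mul_assoc]

/-- On `V`, the extension by `1` of a gauge function `k : V → G` (Mathlib `Function.extend Subtype.val k 1`)
is `k`. -/
private theorem extend_apply_of_mem (V : Finset (Site 4)) (k : ↥V → G) {x : Site 4} (hx : x ∈ V) :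
    Function.extend Subtype.val k 1 x = k ⟨x, hx⟩ :=
  Subtype.val_injective.extend_apply k 1 ⟨x, hx⟩

/-- Off `V`, the extension by `1` of `k : V → G` is `1`. -/
private theorem extend_apply_of_not_mem (V : Finset (Site 4)) (k : ↥V → G) {x : Site 4} (hx : x ∉ V) :
    Function.extend Subtype.val k 1 x = 1 := by
  rw [Function.extend_apply' k (1 : Site 4 → G) x fun ⟨a, ha⟩ => hx (ha ▸ a.2), Pi.one_apply]

/-- Every finite set of edges has a finite set of sites containing both endpoints `x`, `x + eᵢ` of each of
its edges `(x, i)`. -/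
private theorem exists_finset_endpoints (S : Finset (ZdEdge 4)) :
    ∃ V : Finset (Site 4), ∀ e ∈ S, e.1 ∈ V ∧ e.1 + Pi.single e.2 1 ∈ V :=
  ⟨S.image Prod.fst ∪ S.image fun e : ZdEdge 4 => e.1 + Pi.single e.2 1, fun _ he =>
    ⟨Finset.mem_union_left _ (Finset.mem_image_of_mem Prod.fst he),
      Finset.mem_union_right _ (Finset.mem_image_of_mem (fun e : ZdEdge 4 => e.1 + Pi.single e.2 1) he)⟩⟩

/-- On an edge with both endpoints in `V`, transforming by `ext k · h` and by `ext (k · h|_V)` agree. -/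
private theorem gaugeTransformZd_extend_mul_apply (V : Finset (Site 4)) (k : ↥V → G) (h : Site 4 → G)
    (U : LGConfig 4 G) {e : ZdEdge 4} (h1 : e.1 ∈ V) (h2 : e.1 + Pi.single e.2 1 ∈ V) :
    gaugeTransformZd (Function.extend Subtype.val k 1 * h) U e =
      gaugeTransformZd (Function.extend Subtype.val (k * fun y : ↥V => h y) 1) U e := by
  simp only [gaugeTransformZd, Pi.mul_apply, extend_apply_of_mem V _ h1, extend_apply_of_mem V _ h2]

/-- A cylinder function on `S` composed with `gaugeTransformZd (ext k · h)` only sees `h` at the endpoints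
of `S`: it equals the composition with `gaugeTransformZd (ext (k · h|_V))` when `V` contains these endpoints. -/
private theorem apply_gaugeTransformZd_extend_mul {f : LGConfig 4 G → ℝ} {S : Finset (ZdEdge 4)}
    (hf : DependsOn f (↑S : Set (ZdEdge 4))) {V : Finset (Site 4)}
    (hV : ∀ e ∈ S, e.1 ∈ V ∧ e.1 + Pi.single e.2 1 ∈ V) (k : ↥V → G) (h : Site 4 → G)
    (U : LGConfig 4 G) :
    f (gaugeTransformZd (Function.extend Subtype.val k 1 * h) U) =
      f (gaugeTransformZd (Function.extend Subtype.val (k * fun y : ↥V => h y) 1) U) :=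
  hf fun e he => gaugeTransformZd_extend_mul_apply V k h U (hV e (Finset.mem_coe.1 he)).1
    (hV e (Finset.mem_coe.1 he)).2

/-- A cylinder function on `S` composed with a fixed gauge transformation is again a cylinder function on `S`
(the transformed link `U(x,i) ↦ g(x) U(x,i) g(x+eᵢ)⁻¹` only involves the link itself). -/
private theorem dependsOn_comp_gaugeTransformZd {f : LGConfig 4 G → ℝ} {S : Finset (ZdEdge 4)}
    (hf : DependsOn f (↑S : Set (ZdEdge 4))) (g : Site 4 → G) :
    DependsOn (fun U => f (gaugeTransformZd g U)) (↑S : Set (ZdEdge 4)) :=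
  fun _ _ hUU' => hf fun e he => by simp only [gaugeTransformZd, hUU' e he]

variable [MeasurableSpace G]

/-- Evaluation of the extension `ext k` at a fixed site is measurable in `k`. -/
private theorem measurable_extend_apply (V : Finset (Site 4)) (x : Site 4) :
    Measurable fun k : ↥V → G => Function.extend Subtype.val k 1 x := by
  by_cases hx : x ∈ V
  · simp only [extend_apply_of_mem V _ hx]
    exact measurable_pi_apply _
  · simp only [extend_apply_of_not_mem V _ hx]
    exact measurable_const

variable [TopologicalSpace G] [IsTopologicalGroup G] [CompactSpace G] [BorelSpace G]

/-- The gauge average `f̄ U = ∫ f (gaugeTransformZd (ext k) U) dk` of a function bounded by `C` is bounded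
by `C`. -/
private theorem abs_gaugeAvg_le (V : Finset (Site 4)) {f : LGConfig 4 G → ℝ} {C : ℝ} (hC : ∀ U, |f U| ≤ C)
    (U : LGConfig 4 G) :
    |∫ k, f (gaugeTransformZd (Function.extend Subtype.val k 1) U)
      ∂(Measure.pi fun _ : ↥V => haarProbability G)| ≤ C :=
  abs_integral_le_of_abs_le fun _ => hC _

/-- The gauge average of a cylinder function on `S` is a cylinder function on `S`. -/
private theorem dependsOn_gaugeAvg (V : Finset (Site 4)) {f : LGConfig 4 G → ℝ} {S : Finset (ZdEdge 4)}
    (hf : DependsOn f (↑S : Set (ZdEdge 4))) :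
    DependsOn (fun U : LGConfig 4 G => ∫ k, f (gaugeTransformZd (Function.extend Subtype.val k 1) U)
      ∂(Measure.pi fun _ : ↥V => haarProbability G)) (↑S : Set (ZdEdge 4)) :=
  fun _ _ hUU' => integral_congr_ae (Eventually.of_forall fun _ => dependsOn_comp_gaugeTransformZd hf _ hUU')

/-- **The gauge average of a cylinder function is gauge invariant** when `V` contains the endpoints of its
support: `T` is an action, `f ∘ T_{ext k · h} = f ∘ T_{ext (k · h|_V)}`, and the product Haar measure is
right invariant under `k ↦ k · h|_V` (compact groups are unimodular). -/
private theorem gaugeAvg_gaugeTransformZd {f : LGConfig 4 G → ℝ} {S : Finset (ZdEdge 4)}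
    (hf : DependsOn f (↑S : Set (ZdEdge 4))) {V : Finset (Site 4)}
    (hV : ∀ e ∈ S, e.1 ∈ V ∧ e.1 + Pi.single e.2 1 ∈ V) (h : Site 4 → G) (U : LGConfig 4 G) :
    ∫ k, f (gaugeTransformZd (Function.extend Subtype.val k 1) (gaugeTransformZd h U))
        ∂(Measure.pi fun _ : ↥V => haarProbability G) =
      ∫ k, f (gaugeTransformZd (Function.extend Subtype.val k 1) U)
        ∂(Measure.pi fun _ : ↥V => haarProbability G) := by
  simp_rw [gaugeTransformZd_gaugeTransformZd, apply_gaugeTransformZd_extend_mul hf hV]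
  exact integral_mul_right_eq_self (μ := Measure.pi fun _ : ↥V => haarProbability G)
    (fun k : ↥V → G => f (gaugeTransformZd (Function.extend Subtype.val k 1) U)) fun y : ↥V => h y

omit [CompactSpace G] in
/-- A fixed gauge transformation is a measurable self-map of the configuration space. -/
private theorem measurable_gaugeTransformZd' [SecondCountableTopology G] (g : Site 4 → G) :
    Measurable (gaugeTransformZd g : LGConfig 4 G → LGConfig 4 G) := by
  refine measurable_pi_lambda _ fun e => ?_
  show Measurable fun U : LGConfig 4 G => g e.1 * U e * (g (e.1 + Pi.single e.2 1))⁻¹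
  exact (measurable_const.mul (measurable_pi_apply e)).mul measurable_const

omit [CompactSpace G] in
/-- Joint measurability of `(U, k) ↦ gaugeTransformZd (ext k) U`. -/
private theorem measurable_gaugeTransformZd_extend [SecondCountableTopology G] (V : Finset (Site 4)) :
    Measurable fun p : LGConfig 4 G × (↥V → G) =>
      gaugeTransformZd (Function.extend Subtype.val p.2 1) p.1 := by
  refine measurable_pi_lambda _ fun e => ?_
  show Measurable fun p : LGConfig 4 G × (↥V → G) => Function.extend Subtype.val p.2 1 e.1 * p.1 e *
    (Function.extend Subtype.val p.2 1 (e.1 + Pi.single e.2 1))⁻¹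
  exact (((measurable_extend_apply V e.1).comp measurable_snd).mul
    ((measurable_pi_apply e).comp measurable_fst)).mul
    ((measurable_extend_apply V _).comp measurable_snd).inv

variable [SecondCountableTopology G]

/-- The gauge average of a measurable function is measurable (Fubini measurability). -/
private theorem measurable_gaugeAvg (V : Finset (Site 4)) {f : LGConfig 4 G → ℝ} (hfm : Measurable f) :
    Measurable fun U : LGConfig 4 G => ∫ k, f (gaugeTransformZd (Function.extend Subtype.val k 1) U)
      ∂(Measure.pi fun _ : ↥V => haarProbability G) := by
  have hF : StronglyMeasurable (Function.uncurry fun (U : LGConfig 4 G) (k : ↥V → G) =>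
      f (gaugeTransformZd (Function.extend Subtype.val k 1) U)) :=
    (hfm.comp (measurable_gaugeTransformZd_extend V)).stronglyMeasurable
  exact (hF.integral_prod_right (ν := Measure.pi fun _ : ↥V => haarProbability G)).measurable

/-- **The gauge average has the same expectation as `f`** in every gauge-invariant probability measure
(Fubini, then `∫ f ∘ T_g dμ = ∫ f d(T_g)_* μ = ∫ f dμ`). -/
private theorem integral_gaugeAvg (μ : Measure (LGConfig 4 G)) [IsProbabilityMeasure μ]
    (hμ : ∀ g : Site 4 → G, μ.map (gaugeTransformZd g) = μ) (V : Finset (Site 4))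
    {f : LGConfig 4 G → ℝ} (hfm : Measurable f) {C : ℝ} (hC : ∀ U, |f U| ≤ C) :
    ∫ U, ∫ k, f (gaugeTransformZd (Function.extend Subtype.val k 1) U)
      ∂(Measure.pi fun _ : ↥V => haarProbability G) ∂μ = ∫ U, f U ∂μ := by
  have hint : Integrable (Function.uncurry fun (U : LGConfig 4 G) (k : ↥V → G) =>
      f (gaugeTransformZd (Function.extend Subtype.val k 1) U))
      (μ.prod (Measure.pi fun _ : ↥V => haarProbability G)) := by
    refine Integrable.of_bound
      ((hfm.comp (measurable_gaugeTransformZd_extend V)).aestronglyMeasurable) C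
      (ae_of_all _ fun p => ?_)
    rw [Real.norm_eq_abs]
    exact hC _
  rw [integral_integral_swap hint]
  have hk : ∀ k : ↥V → G,
      ∫ U, f (gaugeTransformZd (Function.extend Subtype.val k 1) U) ∂μ = ∫ U, f U ∂μ := by
    intro k
    have h := integral_map (μ := μ)
      (measurable_gaugeTransformZd' (Function.extend Subtype.val k 1)).aemeasurable
      (hfm.aestronglyMeasurable (μ := μ.map (gaugeTransformZd (Function.extend Subtype.val k 1))))
    rw [hμ] at h
    exact h.symm
  simp_rw [hk]
  simp

/-- **Gauge-invariant probability measures agreeing on gauge-invariant local observables agree on all bounded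
measurable cylinder functions**: the gauge average of `f` over the endpoints of its support is a
gauge-invariant local observable (`LocalGaugeObservable`) with the same `μ`- and `ν`-expectations as `f`. -/
private theorem integral_eq_of_dependsOn (μ ν : Measure (LGConfig 4 G)) [IsProbabilityMeasure μ]
    [IsProbabilityMeasure ν] (hμ : ∀ g : Site 4 → G, μ.map (gaugeTransformZd g) = μ)
    (hν : ∀ g : Site 4 → G, ν.map (gaugeTransformZd g) = ν)
    (hA : ∀ A : LocalGaugeObservable 4 G, ∫ U, A.F U ∂μ = ∫ U, A.F U ∂ν)
    {f : LGConfig 4 G → ℝ} {S : Finset (ZdEdge 4)} (hf : DependsOn f (↑S : Set (ZdEdge 4)))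
    (hfm : Measurable f) {C : ℝ} (hC : ∀ U, |f U| ≤ C) :
    ∫ U, f U ∂μ = ∫ U, f U ∂ν := by
  -- a finite set of sites containing both endpoints of every edge of `S`
  obtain ⟨V, hV⟩ := exists_finset_endpoints S
  -- the gauge average of `f` over `V` is a gauge-invariant local observable; apply the hypothesis to it
  have h : ∫ U, ∫ k, f (gaugeTransformZd (Function.extend Subtype.val k 1) U)
        ∂(Measure.pi fun _ : ↥V => haarProbability G) ∂μ =
      ∫ U, ∫ k, f (gaugeTransformZd (Function.extend Subtype.val k 1) U)
        ∂(Measure.pi fun _ : ↥V => haarProbability G) ∂ν :=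
    hA { F := fun U : LGConfig 4 G => ∫ k, f (gaugeTransformZd (Function.extend Subtype.val k 1) U)
          ∂(Measure.pi fun _ : ↥V => haarProbability G)
         supp := S
         isCylinder := dependsOn_gaugeAvg V hf
         gaugeInvariant := fun h U => gaugeAvg_gaugeTransformZd hf hV h U
         bounded := ⟨C, abs_gaugeAvg_le V hC⟩
         measurable := measurable_gaugeAvg V hfm }
  rwa [integral_gaugeAvg μ hμ V hfm hC, integral_gaugeAvg ν hν V hfm hC] at h

/-- **Gauge-invariant probability measures agreeing on gauge-invariant local observables are equal**
(the measurable cylinder sets form a π-system generating the product σ-algebra, and their indicators are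
bounded measurable cylinder functions). -/
private theorem measure_eq_of_gaugeInvariant_of_forall_integral_eq (μ ν : Measure (LGConfig 4 G))
    [IsProbabilityMeasure μ] [IsProbabilityMeasure ν]
    (hμ : ∀ g : Site 4 → G, μ.map (gaugeTransformZd g) = μ)
    (hν : ∀ g : Site 4 → G, ν.map (gaugeTransformZd g) = ν)
    (hA : ∀ A : LocalGaugeObservable 4 G, ∫ U, A.F U ∂μ = ∫ U, A.F U ∂ν) : μ = ν := by
  refine ext_of_generate_finite (measurableCylinders fun _ : ZdEdge 4 => G)
    generateFrom_measurableCylinders.symm isPiSystem_measurableCylinders ?_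
    (by rw [measure_univ, measure_univ])
  intro A hAc
  have hms : MeasurableSet A := MeasurableSet.of_mem_measurableCylinders hAc
  obtain ⟨s, B, -, rfl⟩ := (mem_measurableCylinders A).1 hAc
  have hdep : DependsOn ((cylinder s B).indicator (1 : LGConfig 4 G → ℝ)) (↑s : Set (ZdEdge 4)) := by
    intro U U' hUU'
    have hr : s.restrict U = s.restrict U' := funext fun i => hUU' i (Finset.mem_coe.2 i.2)
    exact Set.indicator_const_eq_indicator_const (Iff.of_eq (congrArg (· ∈ B) hr))
  have hbd : ∀ U, |(cylinder s B).indicator (1 : LGConfig 4 G → ℝ) U| ≤ 1 := by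
    intro U
    by_cases hU : U ∈ cylinder s B
    · simp [Set.indicator_of_mem hU]
    · simp [Set.indicator_of_notMem hU]
  have h := integral_eq_of_dependsOn μ ν hμ hν hA hdep (measurable_one.indicator hms) hbd
  rw [integral_indicator_one hms, integral_indicator_one hms] at h
  exact (measureReal_eq_measureReal_iff (measure_ne_top μ _) (measure_ne_top ν _)).1 h

end GaugeAveraging

/-- **Stub `stub_dlr_eq_of_gaugeInvariantAgreement` (EZ2) of line `Sketch` v7** (crux stmt-QuantumFields-16405,
`NonSimplyConnectedLatticeGap`, route `ConvexGribovBody`): two DLR states of the lattice Yang–Mills specification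
`ymSpecification ρ β` on `ℤ⁴` which are gauge invariant and have equal expectations of all gauge-invariant local
observables coincide. Proof: gauge averaging turns every bounded measurable cylinder function into a
gauge-invariant local observable with the same `μ`- and `ν`-expectations, so `μ` and `ν` agree on the π-system
of measurable cylinder sets, which generates the product σ-algebra. -/
theorem stub_dlr_eq_of_gaugeInvariantAgreement : ∀ (G : Type) [Group G] [TopologicalSpace G] [IsTopologicalGroup G] [CompactSpace G] [MeasurableSpace G] [BorelSpace G] [SecondCountableTopology G] [T2Space G] (N : ℕ) (ρ : G →* Matrix (Fin N) (Fin N) ℂ), Continuous ρ → ∀ (β : ℝ) (μ ν : MeasureTheory.Measure (Literature.MathematicalPhysics.QuantumLattice.LGConfig 4 G)), μ ∈ Literature.MathematicalPhysics.QuantumLattice.ymGibbsMeasures ρ β → ν ∈ Literature.MathematicalPhysics.QuantumLattice.ymGibbsMeasures ρ β → (∀ g : Literature.Probability.LatticeModels.Site 4 → G, μ.map (Literature.MathematicalPhysics.QuantumLattice.gaugeTransformZd g) = μ) → (∀ g : Literature.Probability.LatticeModels.Site 4 → G, ν.map (Literature.MathematicalPhysics.QuantumLattice.gaugeTransformZd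 g) = ν) → (∀ A : Literature.MathematicalPhysics.QuantumLattice.LocalGaugeObservable 4 G, ∫ U, A.F U ∂μ = ∫ U, A.F U ∂ν) → μ = ν := by
  intro G _ _ _ _ _ _ _ _ N ρ _ β μ ν hμ hν hμg hνg hA
  haveI : IsProbabilityMeasure μ := hμ.1
  haveI : IsProbabilityMeasure ν := hν.1
  exact measure_eq_of_gaugeInvariant_of_forall_integral_eq μ ν hμg hνg hA

end Summit.QuantumFields.YangMills.Theorems.NonSimplyConnectedLatticeGap

end
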